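import Summits.BirchSwinnertonDyer.BirchSwinnertonDyer.Theses.ShaPrimaryTransfer
import Summits.BirchSwinnertonDyer.BirchSwinnertonDyer.Theses.KatoTransfer
import Summits.BirchSwinnertonDyer.BirchSwinnertonDyer.Theses.TangentCone
import Literature.NumberTheory.EllipticCurves.IwasawaLeadingTermProofs
import Literature.NumberTheory.EllipticCurves.SupersingularDensityProofs
import Literature.NumberTheory.EllipticCurves.BSDpVariableChangeProofs

/-!
# BirchSwinnertonDyer / ShaPrimaryTransfer — crux `FiniteShaComponentTransfer` (stmt-BirchSwinnertonDyer-22356):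
# the split X1 ⇝ (T, O) against KatoTransfer's X1 and stmt-0132, by name

Route `ShaPrimaryTransfer` REPLACES KatoTransfer's X1 = `KatoTransfer.ShaCorankZeroAtOnePrime` (stmt-18411:
every `E/ℚ`, on a global minimal model, has ONE good ordinary `p ≥ 5` with `corank_{ℤ_p} Ш(E)[p^∞] = 0`) by
T = `FiniteShaComponentTransfer` (stmt-22356) and O = `OneFiniteShaComponent` (stmt-22357: SOME prime, any
prime, with `corank Ш(E)[p₀^∞] = 0`). This helper file (prover seat `bsd-line-spt-p1`, `--supports stmt-22356
--as helper`) records the exact logical position of the split among the REGISTERED items, all by name and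
all unconditional (pure logic over two tree theorems: the invariance of `t_p(E) = 0` under a change of
Weierstrass model, and the existence of a good ordinary prime `p ≥ 5` for every `E/ℚ`, Serre/Deuring,
tree theorem `infinite_goodOrdinaryPrimes_holds`):

* `oneFiniteShaComponent_of_shaCorankZeroAtOnePrime` — **O is WEAKER than X1** (X1's prime is a door
  prime; O is stated for every model, X1 on minimal models, bridged by `hasGlobalMinimalModel_rat_holds` and
  the isomorphism invariance of `t_p = 0`).
* `shaCorankZeroAtOnePrime_of_transfer_of_door` — **T ∧ O ⟹ X1** (the route's kernel gives `t_q = 0` at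
  every `q`; an admissible `q` exists).
* `selmerRankShaPFinite_of_shaCorankZeroAtOnePrime_of_transfer` — **X1 ∧ T ⟹ stmt-0132**
  (`TangentCone.SelmerRankShaPFinite`: every `Ш(E)[p^∞]` finite): transfer X1's prime to every prime on a
  minimal model, carry back along the isomorphism.
* `door_tfae_of_transfer` — **granting T, the three statements O, X1, stmt-0132 are EQUIVALENT**. So the
  split isolates in T exactly the class-wide content that separates the per-curve door (O, or X1) from the
  prime-by-prime finiteness of `Ш` (stmt-0132); T itself is conjecture-grade at analytic rank ≥ 2
  (companion files `…Slices`, `…Sectors`). Nothing here proves T, O, X1, stmt-0132 or BSD.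

References: R. Greenberg, LNM 1716 (1999), §1; J.-P. Serre, Publ. Math. IHÉS 54 (1981), §8 Cor. 2;
J. H. Silverman, *AEC*, VIII.8.3 and X.§4 Rem. 4.1.1.
-/

-- D-0017: single-problem summit, so `Summit.BirchSwinnertonDyer.BirchSwinnertonDyer.…` repeats a namespace BY DESIGN.
set_option linter.dupNamespace false

noncomputable section

namespace Summit.BirchSwinnertonDyer.BirchSwinnertonDyer.Theorems.ShaPrimaryTransferVersusX1

open scoped Classical
open Literature.NumberTheory.EllipticCurves
open WeierstrassCurve
open Summit.BirchSwinnertonDyer.BirchSwinnertonDyer.Theses.ShaPrimaryTransfer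
  (FiniteShaComponentTransfer OneFiniteShaComponent)
open Summit.BirchSwinnertonDyer.BirchSwinnertonDyer.Theses.KatoTransfer (ShaCorankZeroAtOnePrime)
open Summit.BirchSwinnertonDyer.BirchSwinnertonDyer.Theses.TangentCone (SelmerRankShaPFinite)

/-! ## Transport of `t_p = 0` along a change of model (inlined tree theorems) -/

/-- From `corank_{ℤ_p} Ш(C • W)[p^∞] = 0` to `corank_{ℤ_p} Ш(W)[p^∞] = 0`: `t_p = 0 ↔ Ш[p^∞]` finite (tree
theorem `finite_primaryComponent_sha_iff_shaCorank_eq_zero`) and finiteness of `Ш[p^∞]` is an isomorphism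
invariant (tree theorem `finite_primaryComponent_sha_variableChange_iff`). Stated one-directionally for an
arbitrary model `W` and a change of variables `C` (the form the minimal-model bridge uses).
[cite: SilvermanAEC2009, X.§4 Rem. 4.1.1] -/
theorem shaCorank_eq_zero_of_shaCorank_smul_eq_zero (W : WeierstrassCurve ℚ) [W.IsElliptic]
    (C : VariableChange ℚ) (p : ℕ) [Fact p.Prime] (h0 : (C • W).shaCorank p = 0) : W.shaCorank p = 0 :=
  (finite_primaryComponent_sha_iff_shaCorank_eq_zero W p).1
    ((finite_primaryComponent_sha_variableChange_iff W C p).1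
      ((finite_primaryComponent_sha_iff_shaCorank_eq_zero (C • W) p).2 h0))

/-! ## O against X1 -/

/-- **O is weaker than KatoTransfer's X1.** `ShaCorankZeroAtOnePrime → OneFiniteShaComponent`: for an
arbitrary elliptic `W/ℚ` pass to a global minimal model `C • W` (*AEC* VIII.8.3, tree theorem
`hasGlobalMinimalModel_rat_holds`), take X1's prime there, and carry `t_p = 0` back along `C`. [folklore] -/
theorem oneFiniteShaComponent_of_shaCorankZeroAtOnePrime (hX1 : ShaCorankZeroAtOnePrime) :
    OneFiniteShaComponent := by
  intro W _
  obtain ⟨C, hC⟩ := hasGlobalMinimalModel_rat_holds W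
  obtain ⟨p, hp, -, -, -, h0⟩ := hX1 (C • W)
  exact ⟨p, hp, shaCorank_eq_zero_of_shaCorank_smul_eq_zero W C p h0⟩

/-! ## T ∧ O against X1 -/

/-- **The route's kernel lands in X1.** `FiniteShaComponentTransfer → OneFiniteShaComponent →
ShaCorankZeroAtOnePrime`: O gives a door prime `p₀`, T transfers `t_{p₀} = 0` to an admissible prime
(`p ≥ 5` good ordinary, which exists: Serre/Deuring). [cite: Serre1981, §8 Cor. 2] -/
theorem shaCorankZeroAtOnePrime_of_transfer_of_door (hT : FiniteShaComponentTransfer)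
    (hO : OneFiniteShaComponent) : ShaCorankZeroAtOnePrime := by
  intro W _ _
  obtain ⟨p₀, hp₀, h0⟩ := hO W
  -- an admissible prime exists (Serre/Deuring; tree theorem `infinite_goodOrdinaryPrimes_holds`)
  obtain ⟨p, hp, h5, hgood, hord⟩ := exists_good_ordinary_prime_of_infinite infinite_goodOrdinaryPrimes_holds W
  exact ⟨p, hp, h5, hgood, hord, hT W p₀ p h0⟩

/-! ## X1 ∧ T against stmt-0132 -/

/-- **X1 and T together give prime-by-prime finiteness of `Ш`** (stmt-BirchSwinnertonDyer-0132,
`TangentCone.SelmerRankShaPFinite`): on a global minimal model X1 supplies one prime with `t_p = 0`, T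
moves it to every prime, and `t_q = 0 ↔ Ш[q^∞]` finite is carried back along the isomorphism.
[cite: Greenberg1999LNM, §1 pp. 54–57] -/
theorem selmerRankShaPFinite_of_shaCorankZeroAtOnePrime_of_transfer (hX1 : ShaCorankZeroAtOnePrime)
    (hT : FiniteShaComponentTransfer) : SelmerRankShaPFinite := by
  intro W _ q _
  obtain ⟨C, hC⟩ := hasGlobalMinimalModel_rat_holds W
  obtain ⟨p, hp, -, -, -, h0⟩ := hX1 (C • W)
  have hq : (C • W).shaCorank q = 0 := hT (C • W) p q h0
  exact (finite_primaryComponent_sha_iff_shaCorank_eq_zero W q).2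
    (shaCorank_eq_zero_of_shaCorank_smul_eq_zero W C q hq)

/-! ## Granting T: O, X1 and stmt-0132 coincide -/

/-- **Granting the transfer T, the door O, KatoTransfer's X1 and stmt-0132 are equivalent.** T is exactly
the class-wide statement separating a per-curve door (at any prime, or at an admissible one) from the
prime-by-prime finiteness of `Ш(E/ℚ)` for every `E`. [cite: Greenberg1999LNM, §1 pp. 54–57]
[cite: Serre1981, §8 Cor. 2] -/
theorem door_tfae_of_transfer (hT : FiniteShaComponentTransfer) :
    List.TFAE [OneFiniteShaComponent, ShaCorankZeroAtOnePrime, SelmerRankShaPFinite] := by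
  tfae_have 1 → 2 := fun hO => shaCorankZeroAtOnePrime_of_transfer_of_door hT hO
  tfae_have 2 → 3 := fun hX1 => selmerRankShaPFinite_of_shaCorankZeroAtOnePrime_of_transfer hX1 hT
  tfae_have 3 → 1 := fun h W _ =>
    -- stmt-0132 gives O outright: any prime (here `2`) is a witness
    ⟨2, ⟨Nat.prime_two⟩, (@finite_primaryComponent_sha_iff_shaCorank_eq_zero ℚ _ _ W 2 ⟨Nat.prime_two⟩ _).1
      (@h W _ 2 ⟨Nat.prime_two⟩)⟩
  tfae_finish

end Summit.BirchSwinnertonDyer.BirchSwinnertonDyer.Theorems.ShaPrimaryTransferVersusX1
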